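import Summits.ValiantsHypothesis.ValiantsHypothesis.Theorems.SymPencilKernelFixedRankCodim
import Summits.ValiantsHypothesis.ValiantsHypothesis.Theorems.SymPencilHomogeneousConeKernel

/-!
# Route `SymPencil` — Case I of the kernel-row dichotomy: a kernel direction forces
# `rank A₀ ≤ 2 (m - N + 1)` (structural lemma toward `SdcSuperquadratic`, stmt-ValiantsHypothesis-5674)

General-size form of `SymPencilHomogeneousConeKernel.rank_constPart_le_two` (which is the case
`m = N`).  `k` of characteristic `0`, `f ∈ k[σ]` homogeneous of degree `n ≥ 2`, `|σ| = N`,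
`A = A₀ + Σ_v X_v A_v` a SYMMETRIC affine determinantal representation of `f` of size
`m = |ι| ≥ n`, `x ≠ 0` a zero of `f` with `rank A(x) ≥ m - 1` and NONDEGENERATE Hessian, `w ≠ 0` a
kernel vector of `A(x)`.  The kernel-row map `Φ : y ↦ M(y) w` always has rank `≥ N - 1`
(`rank Hess f (x) ≤ rank Φ + 1`, `SymPencilKernelRowRank`).  **Case I**: `Φ` has a nontrivial
kernel (`Φ d = 0`, `d ≠ 0`).  Then (`rank_constPart_add_le`)

  `rank A₀ + 2 N ≤ 2 m + 2`, i.e. `rank A₀ ≤ 2 (m - N + 1)`.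

Proof: exactly the cone-kernel argument of the `m = N` file — two-sided vanishing gives
`Hess f (x) d = κ γ` (`γ_v = wᵀ A_v w`), Jacobi `∇ f (x) = c₀ γ`, Euler `Hess f (x) x = (n-1) ∇ f (x)`,
nondegeneracy forces `d ∥ x`, hence `A₀ w = 0` — followed by the codimension-`c` bridge
`SymPencilKernelFixedRankCodim.rank_add_two_mul_finrank_le_of_kernelRow` applied to the image of
`Φ` (dimension `≥ N - 1`, codimension `≤ m - N + 1`).

For the permanent (`SymPencilKernelRowInjective.lean`): `rank A(0) = m - 1` (von zur Gathen /
Alper–Bogart–Velasco regularity), so Case I forces `m ≥ 2n² - 3`; below that, the kernel-row map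
at every nondegenerate zero is injective ("Case II"), which is therefore the whole remaining
content of `SdcSuperquadratic` in the range `n² + 1 ≤ m ≤ 2n² - 4`. [folklore]
-/

noncomputable section

-- single-conjunct layout: Sub = Summit, duplicated namespace component intended
set_option linter.dupNamespace false

namespace Summit.ValiantsHypothesis.ValiantsHypothesis.Theorems.SymPencilConeKernelCodim

open Matrix MvPolynomial
open Literature.Computability.AlgebraicComplexity
open Summit.ValiantsHypothesis.ValiantsHypothesis.Theorems.SymPencilHomogeneousHessianRank
open Summit.ValiantsHypothesis.ValiantsHypothesis.Theorems.SymPencilKernelRowRank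
open Summit.ValiantsHypothesis.ValiantsHypothesis.Theorems.SymPencilKernelFixedRankCodim
open Summit.ValiantsHypothesis.ValiantsHypothesis.Theorems.SymPencilHomogeneousConeKernel

universe u

variable {k : Type u} [Field k] [CharZero k]

/-- **Case I of the kernel-row dichotomy.**  For `f` homogeneous of degree `n ≥ 2` with a
symmetric affine determinantal representation `A` of size `|ι| ≥ n`, a zero `x ≠ 0` of `f` with
`rank A(x) ≥ |ι| - 1` and NONDEGENERATE Hessian, a kernel vector `w ≠ 0` of `A(x)`, and a nonzero
`d` in the kernel of the kernel-row map `y ↦ (Σ_v y_v A_v) w`, the constant part satisfies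
`rank A₀ + 2 |σ| ≤ 2 |ι| + 2`. [folklore] -/
theorem rank_constPart_add_le {σ : Type*} [Fintype σ] [DecidableEq σ]
    {ι : Type*} [Fintype ι] [DecidableEq ι] {f : MvPolynomial σ k} {n : ℕ}
    (hf : f.IsHomogeneous n) (hn : 2 ≤ n) {A : Matrix ι ι (MvPolynomial σ k)} (hAs : A.IsSymm)
    (hA : IsAffineDetRepr f A) (x : σ → k) (hx0 : x ≠ 0)
    (hHess : (hessianMatrix f x).rank = Fintype.card σ)
    (hcork : Fintype.card ι ≤ (A.map (eval x)).rank + 1) (hnm : n ≤ Fintype.card ι)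
    (w : ι → k) (hw : w ≠ 0) (hwA : A.map (eval x) *ᵥ w = 0)
    (d : σ → k) (hd0 : d ≠ 0) (hd : (∑ v, d v • LRPencil.coeffMat A v) *ᵥ w = 0) :
    (constPart A).rank + 2 * Fintype.card σ ≤ 2 * Fintype.card ι + 2 := by
  classical
  obtain ⟨hdeg, hdet⟩ := hA
  -- the affine chain rule `Hess f (x) = Lᵀ · Hess DET (Y) · L`
  have hfa : f = aeval (fun p : ι × ι => A p.1 p.2) (detPoly ι k) := by
    rw [detPoly, AlgHom.map_det, mvPolynomialX_mapMatrix_aeval k A, hdet]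
  have hφ : ∀ (t : ι × ι) (u v : σ), pderiv u (pderiv v (A t.1 t.2)) = 0 := fun t u v =>
    pderiv_pderiv_eq_zero_of_totalDegree_le_one (hdeg t.1 t.2) u v
  set Y : Matrix ι ι k := Matrix.of fun i j => eval x (A i j) with hYdef
  have hYA : A.map (eval x) = Y := by ext i j; rfl
  have hYs : Y.IsSymm := Matrix.IsSymm.ext fun i j => by
    simp only [hYdef, of_apply, hAs.apply i j]
  have hwY : Y *ᵥ w = 0 := by rw [← hYA]; exact hwA
  have hwY' : w ᵥ* Y = 0 := by
    rw [← hYs.eq, vecMul_transpose, hwY]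
  set L : Matrix (ι × ι) σ k := Matrix.of fun (t : ι × ι) (v : σ) => eval x (pderiv v (A t.1 t.2))
    with hLdef
  set Pw : Matrix ι (ι × ι) k := Matrix.of fun (j : ι) (q : ι × ι) => if q.2 = j then w q.1 else 0
    with hPw
  have hHessL : hessianMatrix f x =
      Lᵀ * hessianMatrix (detPoly ι k) (fun t : ι × ι => eval x (A t.1 t.2)) * L := by
    conv_lhs => rw [hfa, hessianMatrix_aeval_of_affine _ hφ]
  have hbound : (hessianMatrix f x).rank ≤ (Pw * L).rank + 1 := by
    rw [hHessL]
    refine rank_transpose_mul_mul_le_rank_add_one _ w hw (fun Z Z' h1 h2 h3 => ?_) _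
      (fun i j v => by simp only [hLdef, of_apply, hAs.apply i j])
    exact Summit.ValiantsHypothesis.Theorems.dotProduct_hessianMatrix_detPoly_mulVec_eq_zero_of_two_sided
      Y (Matrix.of fun i j => Z (i, j)) (Matrix.of fun i j => Z' (i, j)) w hw hwY' hwY h1 h2 h3
  -- the pencil `A = A₀ + Σ_v X_v A_v`
  set A₀ : Matrix ι ι k := constPart A with hA₀
  let Mlin : (σ → k) →ₗ[k] Matrix ι ι k :=
    { toFun := fun z => ∑ v, z v • LRPencil.coeffMat A v
      map_add' := fun z₁ z₂ => by
        simp only [Pi.add_apply, add_smul, Finset.sum_add_distrib]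
      map_smul' := fun c z => by
        simp only [Pi.smul_apply, smul_eq_mul, mul_smul, Finset.smul_sum, RingHom.id_apply] }
  have hMlin : ∀ z, Mlin z = ∑ v, z v • LRPencil.coeffMat A v := fun z => rfl
  have hdker : Mlin d *ᵥ w = 0 := by rw [hMlin]; exact hd
  have hAz : ∀ z, A.map (eval z) = A₀ + Mlin z := fun z => by
    rw [hMlin, hA₀]
    exact LRPencil.map_eval_eq A hdeg z
  have hdetz : ∀ z, (A₀ + Mlin z).det = eval z f := fun z => by
    rw [← hAz, ← RingHom.mapMatrix_apply, ← RingHom.map_det, hdet]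
  have hY : Y = A₀ + Mlin x := by rw [← hYA, hAz]
  have hcoeffs : ∀ v, (LRPencil.coeffMat A v)ᵀ = LRPencil.coeffMat A v := fun v => by
    ext i j; simp only [transpose_apply, LRPencil.coeffMat_apply, hAs.apply i j]
  have hA₀s : A₀ᵀ = A₀ := by
    ext i j; simp only [hA₀, transpose_apply, constPart_apply, hAs.apply i j]
  have hMs : ∀ z, (Mlin z)ᵀ = Mlin z := fun z => by
    rw [hMlin, Matrix.transpose_sum]
    exact Finset.sum_congr rfl fun v _ => by rw [Matrix.transpose_smul, hcoeffs]
  -- `(P_w L) y = M(y) w`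
  have hPZ : ∀ Z : ι × ι → k, Pw *ᵥ Z = w ᵥ* (Matrix.of fun i j => Z (i, j)) := by
    intro Z
    ext j
    simp only [hPw, mulVec, dotProduct, of_apply, vecMul, ite_mul, zero_mul]
    rw [Fintype.sum_prod_type]
    simp only [Finset.sum_ite_eq', Finset.mem_univ, if_true]
  have hLM : ∀ y : σ → k, (Matrix.of fun i j => (L *ᵥ y) (i, j)) = Mlin y := by
    intro y
    ext i j
    simp only [of_apply, mulVec, dotProduct, hLdef, hMlin, Matrix.sum_apply, Matrix.smul_apply,
      smul_eq_mul, LRPencil.coeffMat_apply, AlperBogartVelasco.pderiv_eq_C_coeff (hdeg i j),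
      eval_C]
    exact Finset.sum_congr rfl fun v _ => mul_comm _ _
  have hPwL : ∀ y : σ → k, (Pw * L) *ᵥ y = Mlin y *ᵥ w := by
    intro y
    rw [← Matrix.mulVec_mulVec, hPZ, hLM]
    conv_lhs => rw [← hMs y]
    rw [vecMul_transpose]
  -- the homogeneity identity
  obtain ⟨d', hd'⟩ : ∃ d', Fintype.card ι = d' + n := ⟨Fintype.card ι - n, by omega⟩
  have hHom : ∀ (y : σ → k) (ν : k), ν ≠ -1 →
      (Y + Mlin y + ν • A₀).det = (1 + ν) ^ d' * (Y + Mlin y).det := by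
    intro y ν hν
    have h1 : (1 + ν : k) ≠ 0 := fun h => hν (by linear_combination h)
    have hmat : Y + Mlin y + ν • A₀ = (1 + ν) • (A₀ + Mlin ((1 + ν)⁻¹ • (x + y))) := by
      rw [hY, map_smul, map_add, smul_add, smul_smul, mul_inv_cancel₀ h1, one_smul, add_smul,
        one_smul]
      abel
    have hYM : Y + Mlin y = A₀ + Mlin (x + y) := by rw [hY, map_add, add_assoc]
    rw [hmat, Matrix.det_smul, hdetz, eval_smul_of_isHomogeneous hf, hYM, hdetz, hd', pow_add,
      mul_assoc, ← mul_assoc ((1 + ν) ^ n), ← mul_pow, mul_inv_cancel₀ h1, one_pow, one_mul]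
  -- (2a) `Hess f (x) d ⊥ {y : wᵀ M(y) w = 0}`
  set γ : σ → k := fun v => w ⬝ᵥ LRPencil.coeffMat A v *ᵥ w with hγ
  have hγy : ∀ y : σ → k, γ ⬝ᵥ y = w ⬝ᵥ Mlin y *ᵥ w := by
    intro y
    simp only [hγ, dotProduct, Matrix.mulVec, hMlin, Matrix.sum_apply, Matrix.smul_apply,
      smul_eq_mul, Finset.sum_mul, Finset.mul_sum]
    rw [Finset.sum_comm]
    refine Finset.sum_congr rfl fun i _ => ?_
    rw [Finset.sum_comm]
    exact Finset.sum_congr rfl fun j _ => Finset.sum_congr rfl fun v _ => by ring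
  have hvan : ∀ y : σ → k, γ ⬝ᵥ y = 0 → (hessianMatrix f x *ᵥ d) ⬝ᵥ y = 0 := by
    intro y hy
    rw [hγy] at hy
    rw [hHessL, ← Matrix.mulVec_mulVec, ← Matrix.mulVec_mulVec, dotProduct_comm,
      Matrix.dotProduct_mulVec, vecMul_transpose]
    have hsymZ : ∀ Z Z' : ι × ι → k, Z ⬝ᵥ hessianMatrix (detPoly ι k)
        (fun t : ι × ι => eval x (A t.1 t.2)) *ᵥ Z' =
        Z' ⬝ᵥ hessianMatrix (detPoly ι k) (fun t : ι × ι => eval x (A t.1 t.2)) *ᵥ Z := by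
      intro Z Z'
      rw [Matrix.dotProduct_mulVec, ← Matrix.mulVec_transpose, hessianMatrix_transpose,
        dotProduct_comm]
    rw [hsymZ]
    refine Summit.ValiantsHypothesis.Theorems.dotProduct_hessianMatrix_detPoly_mulVec_eq_zero_of_two_sided
      Y (Matrix.of fun i j => (L *ᵥ d) (i, j)) (Matrix.of fun i j => (L *ᵥ y) (i, j)) w hw hwY'
      hwY ?_ ?_ ?_
    · rw [hLM]
      conv_lhs => rw [← hMs d]
      rw [vecMul_transpose, hdker]
    · rw [hLM, hdker]
    · rw [hLM, hy]
  obtain ⟨κ, hκ⟩ := exists_eq_smul_of_forall_dotProduct _ γ hvan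
  -- (2b) Jacobi: `∇ f (x) = c₀ γ`
  obtain ⟨c₀, hc₀⟩ := adjugate_eq_smul_vecMulVec hYs.eq hw hwY (by rwa [hYA] at hcork)
  set g : σ → k := fun v => eval x (pderiv v f) with hg
  have hgγ : g = c₀ • γ := by
    ext v
    simp only [hg, Pi.smul_apply, smul_eq_mul, hγ]
    rw [← hdet, DeterminantalConormal.eval_pderiv_det, hYA, hc₀]
    have hcoe : A.map (fun p => eval x (pderiv v p)) = LRPencil.coeffMat A v := by
      ext i j
      simp only [Matrix.map_apply, LRPencil.coeffMat_apply,
        AlperBogartVelasco.pderiv_eq_C_coeff (hdeg i j), eval_C]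
    rw [hcoe, Matrix.smul_mul, Matrix.trace_smul, Matrix.vecMulVec_mul, Matrix.trace_vecMulVec,
      smul_eq_mul, ← Matrix.mulVec_transpose, hcoeffs]
  -- (2c) Euler: `Hess f (x) x = (n - 1) ∇ f (x)`
  have hEuler' : ∀ u, (hessianMatrix f x *ᵥ x) u = ((n - 1 : ℕ) : k) * g u := by
    intro u
    have h := congr_arg (eval x) ((hf.pderiv (i := u)).sum_X_mul_pderiv)
    rw [map_sum, map_nsmul, nsmul_eq_mul] at h
    simp only [map_mul, eval_X] at h
    simp only [mulVec, dotProduct, hessianMatrix_apply, hg]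
    rw [← h]
    exact Finset.sum_congr rfl fun v _ => by rw [pderiv_pderiv_comm, mul_comm]
  have hEuler : hessianMatrix f x *ᵥ x = ((n - 1 : ℕ) : k) • g := by
    ext u
    rw [hEuler' u, Pi.smul_apply, smul_eq_mul]
  -- (2d) nondegeneracy
  have hnondeg : ∀ z : σ → k, hessianMatrix f x *ᵥ z = 0 → z = 0 := by
    intro z hz
    have hdetH : (hessianMatrix f x).det ≠ 0 := by
      intro h0
      have := Matrix.rank_lt_card_of_det_eq_zero h0
      omega
    exact Matrix.eq_zero_of_mulVec_eq_zero hdetH hz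
  have hn1 : ((n - 1 : ℕ) : k) ≠ 0 := by
    exact_mod_cast (show n - 1 ≠ 0 by omega)
  have hg0 : g ≠ 0 := by
    intro h0
    exact hx0 (hnondeg _ (by rw [hEuler, h0, smul_zero]))
  have hc₀0 : c₀ ≠ 0 := by
    rintro rfl
    exact hg0 (by rw [hgγ, zero_smul])
  -- (2e) `d ∥ x`, so the kernel is fixed along the cone line: `A₀ w = 0`
  have hpar : κ • x = (((n - 1 : ℕ) : k) * c₀) • d := by
    have hz : hessianMatrix f x *ᵥ (κ • x - (((n - 1 : ℕ) : k) * c₀) • d) = 0 := by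
      rw [Matrix.mulVec_sub, Matrix.mulVec_smul, Matrix.mulVec_smul, hEuler, hκ, hgγ]
      ext u
      simp only [Pi.sub_apply, Pi.smul_apply, smul_eq_mul, Pi.zero_apply]
      ring
    exact sub_eq_zero.1 (hnondeg _ hz)
  have hκ0 : κ ≠ 0 := by
    intro h0
    rw [h0, zero_smul] at hpar
    exact hd0 ((smul_eq_zero.1 hpar.symm).resolve_left (mul_ne_zero hn1 hc₀0))
  have hMxw : Mlin x *ᵥ w = 0 := by
    have h := congr_arg (fun z => Mlin z *ᵥ w) hpar
    simp only [map_smul, Matrix.smul_mulVec, hdker, smul_zero] at h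
    exact (smul_eq_zero.1 h).resolve_left hκ0
  have hA₀w : A₀ *ᵥ w = 0 := by
    have h := hwY
    rw [hY, Matrix.add_mulVec, hMxw, add_zero] at h
    exact h
  -- (3) the image of the kernel-row map has codimension `≤ m - N + 1`; apply the bridge
  have h1 : ∃ y : σ → k, w ⬝ᵥ Mlin y *ᵥ w ≠ 0 := by
    have hγ0 : γ ≠ 0 := by
      rintro h0
      exact hg0 (by rw [hgγ, h0, smul_zero])
    obtain ⟨v, hv⟩ : ∃ v, γ v ≠ 0 := Function.ne_iff.mp hγ0
    exact ⟨Pi.single v 1, by rwa [← hγy, dotProduct_single_one]⟩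
  set R := LinearMap.range (Pw * L).mulVecLin with hR
  have hRsurj : ∀ z ∈ R, ∃ y : σ → k, Mlin y *ᵥ w = z := by
    intro z hz
    obtain ⟨y, hy⟩ := hz
    exact ⟨y, by rw [← hPwL]; exact hy⟩
  have hRdim : Module.finrank k R = (Pw * L).rank := rfl
  have h2 := rank_add_two_mul_finrank_le_of_kernelRow Y A₀ hYs.eq hA₀s w hw hwY hA₀w
    (by rwa [hYA] at hcork) Mlin hMs d' hHom h1 R hRsurj
  rw [hRdim] at h2
  rw [hHess] at hbound
  omega

end Summit.ValiantsHypothesis.ValiantsHypothesis.Theorems.SymPencilConeKernelCodim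

end
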